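import Literature.AlgebraicGeometry.Ramification.InertiaNormalSylow
import Literature.AlgebraicGeometry.Resolution.Blowups
import Mathlib.AlgebraicGeometry.Morphisms.Etale
import Mathlib.AlgebraicGeometry.Morphisms.FiniteType
import Mathlib.Algebra.CharP.Defs
import HarnessLib

/-!
# Abbes–Saito: after a `U`-admissible blow-up and normalisation, every inertia group has a
# normal `p`-Sylow subgroup (property (NpS) everywhere) — named fact

Topic `Literature/AlgebraicGeometry/Ramification`; companion of `InertiaNormalSylow.lean` (the
carrier `InertiaNormalSylow p f ρ hρ` = Abbes–Saito's property (NpS) at every point, Def. 2.12).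
NAMED FACT (D-0014) requested by route `ResolutionOfSingularities/CleanCovers` (items
`CleanSolvableModel` stmt-15108 / `CleanCoverLogRegular` stmt-15109; cite item wi-32388): the
UNCONDITIONAL base-side solvabilisation of inertia, Abbes–Saito 2011, Prop. 2.22 (= (NS4)).

## Source, verbatim (A. Abbes, T. Saito, *Ramification and cleanliness*, Tohoku Math. J. (2) 63
## (2011) 775–853 = arXiv:1007.3873v3, §2; numbering of v3 = the journal, checked on the TeX source)

* **2.1** "In this article, we fix a prime number `p`, a perfect field `k` of characteristic `p` […]
  All `k`-schemes are assumed to be separated of finite type over `k`."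
* **2.3** "Let `X` be a locally noetherian scheme. In this article, a *Galois torsor* over `X` of
  group `G` stands for a torsor over `X` for the étale topology under a finite constant group `G`,
  that is, a principal covering of `X` of Galois group `G` in the sense of ([SGA 1] V 2.8)."
* **2.4** "Let `X` be a normal and locally noetherian scheme, `U` a dense open subscheme of `X`,
  `V` a Galois torsor over `U` of group `G`, and `Y` the integral closure of `X` in `V`. Then `G`
  acts on `Y` and we have `X = Y/G`. […] the inertia group `I_y` of `y` is the subgroup of
  elements `σ ∈ G` such that `g(y) = y` and that `g` acts trivially on `κ(y)`. It is convenient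
  to denote `I_y` also by `I_ȳ` […] Assume that `X` is *universally Japanese*, which means that
  every point of `X` has an affine open neighborhood whose ring is universally Japanese
  ([EGA IV] 0.23.1.1)." **2.5** "Recall that a scheme locally of finite type over a universally
  Japanese scheme is universally Japanese, and that the ring `ℤ` (resp. any field) is universally
  Japanese ([EGA IV] 7.7.4)."
* **Definition 2.12** (property (NpS) at `x̄`): "for every geometric point `ȳ` of `Y` above `x̄`,
  the inertia group `I_ȳ` of `ȳ` has a normal `p`-Sylow subgroup" — the tree's
  `InertiaNormalSylowAt` / `InertiaNormalSylow` (`InertiaNormalSylow.lean`).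
* **Lemma 2.10.** "Let `A` be a strictly henselian valuation ring, with fraction field `K` and
  residue field of characteristic `p` […] Then `G` [`= Gal(K̄/K)`] has a normal `p`-Sylow subgroup
  `P`, and the quotient `I^t = G/P` is abelian."
* **Lemma 2.15** (base change). "Let `X, X'` be normal, locally noetherian and universally
  Japanese schemes, […] `f : X' → X` a morphism, `U' = f⁻¹(U)`, `V' = U' ×_U V`, `Y'` the integral
  closure of `X'` in `V'` […] Then `I_{ȳ'} ⊂ I_ȳ`. In particular, if `V/U` has the property (NpS)
  at `x̄`, `V'/U'` has the property (NpS) at `x̄'`."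
* **Proposition 2.16.** "Let `A` be a ring, `t ∈ A`, `X = Spec(A)`, `U = Spec(A_t)`, `B` a finite
  sub-`A`-algebra of `A_t` and `Y = Spec(B)`. Assume that `t` is not a zero divisor in `A`. Then the
  canonical morphism `Y → X` is a `U`-admissible blow-up." ("We refer to ([Raynaud–Gruson] 5.1
  and [Abbes, EGR 1] 1.13) for generalities on admissible blow-ups.")
* **Proposition 2.22** (= (NS4)). "Let `X` be a normal, locally noetherian and universally
  Japanese scheme, `U` a dense open subscheme, and `V` a Galois torsor over `U`. Then there exists
  a `U`-admissible blow-up `φ : X' → X`, such that if we denote by `X''` the normalization of `X'`,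
  `V/U` has the property (NpS) at every geometric point of `X''`." Proof (pp. 12–13 of the arXiv
  text): reduce to `U = X − D`, `D` an effective Cartier divisor; on the Zariski–Riemann space
  `X_ZR = lim X''` (Lemmas 2.20, 2.21) the inertia group at a point of a normal model above
  `ξ ∈ X_ZR` "is isomorphic to a quotient of `𝒢`", the absolute Galois group of the strictly
  henselian VALUATION ring at `ξ`; "Therefore, by 2.10, `V/U` has property (NpS)"; conclude by
  the quasi-compactness of `X_ZR` and the cofinality of normal models.

## Rendering (a SPECIAL CASE with the carriers in the tree; hypotheses complete)

* `p` is the prime FIXED in 2.1, and the proof of 2.22 applies Lemma 2.10, which needs the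
  residue field of the valuation ring at every point of `X_ZR` to have characteristic `p`: the
  statement is meant for (and only used for, §8) schemes over the field `k` of characteristic `p`.
  It is rendered here for `X` LOCALLY OF FINITE TYPE over a field `k` of characteristic `p`
  (`[CharP k p]`, `LocallyOfFiniteType (X ⟶ Spec k)`): such an `X` is locally noetherian and
  universally Japanese (2.5), and all its residue fields have characteristic `p`. Mathlib has no
  notion of (universally) Japanese ring or scheme. TODO(general form): `X` normal, locally
  noetherian, universally Japanese over `𝔽_p`.
* "`X` normal": every local ring `𝒪_{X,x}` is an integrally closed domain (Stacks 033H; the tree's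
  usual rendering `IsDomain ∧ IsIntegrallyClosed` of the stalks). "`U` a dense open subscheme":
  `U : X.Opens` with `Dense (U : Set X)`.
* "`V` a Galois torsor over `U` of group `G`" (2.3, SGA 1 V 2.8: `G` finite acting on `V` over `U`
  with `G × V ⥲ V ×_U V`, `V → U` finite étale surjective): a finite group `G` acting on the scheme
  `V` by `ρ : G →* Aut V` over `X` (`(ρ g) ≫ f = f`) where `f : V → X` is ÉTALE with image
  EXACTLY `U`, such that the action map `∐_{g ∈ G} V → V ×_X V = V ×_U V`, `(g, v) ↦ (g·v, v)`, is an
  ISOMORPHISM (then `V → U` is a `G`-torsor for the étale topology trivialised by itself, hence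
  finite étale: exactly a principal covering of Galois group `G`).
* "`U`-admissible blow-up `φ : X' → X`" (Raynaud–Gruson 5.1.1; Stacks 080K): a blowing up
  `IsBlowup φ I` (`Resolution/Blowups.lean`, universal property) in an ideal sheaf `I` OF FINITE
  TYPE whose support is DISJOINT from `U` — the rendering of `Resolution/AdmissibleBlowups.lean`.
* "`X''` the normalization of `X'`, `V/U` has (NpS) at every geometric point of `X''`": by Def.
  2.12 (with Lemma 2.15's base change convention, `U'' = U ×_X X'' ≅ U`, `V'' = V`) this says that
  EVERY inertia group of the action of `G` on the integral closure `Y''` of `X''` in `V` has a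
  normal `p`-Sylow subgroup. Now `Y''` is also the integral closure of `X'` in `V` along the lift
  `f' : V → X'` of `f` (`𝒪_{X''} ⊆ f'_*𝒪_V` since `U` is normal, and integral dependence is
  transitive), i.e. Mathlib's relative normalization `f'.normalization` with its induced `G`-action
  (`normalizationAction`), so the conclusion is literally `InertiaNormalSylow p f' ρ hρ'`
  (`inertiaNormalSylow_iff_forall`: all inertia groups on `f'.normalization` have a normal Sylow
  `p`-subgroup) — the normalisation `X''` need not be named. The lift `f'` (unique, as `φ` is an
  isomorphism above `U ⊇ f(V)`) is recorded with `f' ≫ φ = f`, its `G`-invariance and the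
  (automatic) quasi-compactness and quasi-separatedness the carrier requires.

## What is NOT here

Lemma 2.13 / Cor. 2.14 (openness of the (NpS) locus), Lemma 2.15 (base change) and Prop. 2.16 /
Cor. 2.17 as theorems (strict localisations, SGA 4 VIII 7.5, are not in Mathlib); the conditional
snc version §7 (under the resolution hypothesis (RS)); cleanliness (§§3–6).

## References

* [AbbesSaito2011] A. Abbes, T. Saito, Ramification and cleanliness, Tohoku Math. J. (2) 63
  (2011), 775–853 (arXiv:1007.3873v3): 2.1, 2.3, 2.4, 2.5, Lemma 2.10, Def. 2.12, Lemma 2.15,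
  Prop. 2.16, Prop. 2.22 (NS4) and its proof (2.18–2.21).
* [SGA1] Exp. V 2.8 (principal coverings). [RaynaudGruson1971] Première partie 5.1
  (admissible blow-ups). [StacksProject] Tags 080K (admissible blowing up), 033H (normal schemes),
  035H (relative normalization).
-/

noncomputable section

open CategoryTheory CategoryTheory.Limits AlgebraicGeometry

namespace Literature.AlgebraicGeometry.Ramification

universe u

open Literature.AlgebraicGeometry.Resolution

/-- **Abbes–Saito 2011, Prop. 2.22 (= (NS4)): (NpS) after a `U`-admissible blow-up and
normalisation, unconditionally.** Printed: "Let `X` be a normal, locally noetherian and universally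
Japanese scheme, `U` a dense open subscheme, and `V` a Galois torsor over `U`. Then there exists a
`U`-admissible blow-up `φ : X' → X`, such that if we denote by `X''` the normalization of `X'`,
`V/U` has the property (NpS) at every geometric point of `X''`." Rendering (module docstring; the
special case of schemes locally of finite type over a field of characteristic `p`, the prime fixed
in 2.1 — these are locally noetherian and universally Japanese by 2.5): for every prime `p`, field
`k` of characteristic `p`, every NORMAL `k`-scheme `X` locally of finite type, every DENSE open
`U ⊆ X` and every Galois torsor `V → U` of finite group `G` (an action `ρ` of `G` on `V` over `X`,
`f : V → X` étale with image `U`, action map `∐_G V → V ×_X V` an isomorphism), there are a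
`U`-ADMISSIBLE BLOW-UP `φ : X' → X` (a blowing up in an ideal sheaf of finite type with support
disjoint from `U`) and the lift `f' : V → X'` of `f` (`f' ≫ φ = f`, `G`-invariant) such that
`InertiaNormalSylow p f' ρ _` holds: every inertia group `I_y ⊆ G` of the action of `G` on the
integral closure of `X'` — equivalently of its normalisation `X''` — in `V` has a normal Sylow
`p`-subgroup, i.e. `V/U` has (NpS) at every geometric point of `X''`.
[cite: AbbesSaito2011, Prop. 2.22 (NS4), with 2.3, 2.5, Def. 2.12, Lemma 2.15]
[cite: StacksProject, Tag 080K] -/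
def AbbesSaito2011_inertiaNormalSylow_after_admissibleBlowup : Prop :=
  ∀ (p : ℕ) [Fact p.Prime] (k : Type u) [Field k] [CharP k p]
    -- the normal `k`-scheme `X`, locally of finite type, and the dense open `U`
    (X : Scheme.{u}) (sX : X ⟶ Spec (.of k)), LocallyOfFiniteType sX →
    (∀ x : X, IsDomain (X.presheaf.stalk x) ∧ IsIntegrallyClosed (X.presheaf.stalk x)) →
    ∀ (U : X.Opens), Dense (U : Set X) →
    -- the Galois torsor `V → U` of group `G`, through `f : V → X`
    ∀ (G : Type u) [Group G] [Finite G] (V : Scheme.{u}) (f : V ⟶ X) (ρ : G →* Aut V)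
      (hρ : ∀ g, (ρ g).hom ≫ f = f),
      Etale f → Set.range f.base = (U : Set X) →
      IsIso (Sigma.desc fun g : G =>
        pullback.lift (ρ g).hom (𝟙 V) ((hρ g).trans (Category.id_comp f).symm)) →
    -- conclusion: a `U`-admissible blow-up over which all inertia groups have a normal `p`-Sylow
    ∃ (X' : Scheme.{u}) (φ : X' ⟶ X) (I : X.IdealSheafData),
      IsBlowup φ I ∧ (∀ W : X.affineOpens, (I.ideal W).FG) ∧
      Disjoint (U : Set X) (I.support : Set X) ∧
      ∃ (f' : V ⟶ X') (_ : QuasiCompact f') (_ : QuasiSeparated f')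
        (hρ' : ∀ g, (ρ g).hom ≫ f' = f'),
        f' ≫ φ = f ∧ InertiaNormalSylow p f' ρ hρ'

/-- **The conclusion, pointwise** (Def. 2.12 at every point, `inertiaNormalSylow_iff_forall`): under
the fact, for the lift `f' : V → X'` over the `U`-admissible blow-up, EVERY point `y` of the integral
closure `f'.normalization` of `X'` in `V` has an inertia group with a normal Sylow `p`-subgroup.
[cite: AbbesSaito2011, Prop. 2.22 (NS4) and Def. 2.12] -/
theorem AbbesSaito2011_inertiaNormalSylow_after_admissibleBlowup.pointwise
    (h : AbbesSaito2011_inertiaNormalSylow_after_admissibleBlowup.{u})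
    (p : ℕ) [Fact p.Prime] (k : Type u) [Field k] [CharP k p]
    (X : Scheme.{u}) (sX : X ⟶ Spec (.of k)) (hft : LocallyOfFiniteType sX)
    (hN : ∀ x : X, IsDomain (X.presheaf.stalk x) ∧ IsIntegrallyClosed (X.presheaf.stalk x))
    (U : X.Opens) (hU : Dense (U : Set X))
    (G : Type u) [Group G] [Finite G] (V : Scheme.{u}) (f : V ⟶ X) (ρ : G →* Aut V)
    (hρ : ∀ g, (ρ g).hom ≫ f = f) (hf : Etale f) (hfU : Set.range f.base = (U : Set X))
    (htors : IsIso (Sigma.desc fun g : G =>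
      pullback.lift (ρ g).hom (𝟙 V) ((hρ g).trans (Category.id_comp f).symm))) :
    ∃ (X' : Scheme.{u}) (φ : X' ⟶ X) (I : X.IdealSheafData),
      IsBlowup φ I ∧ (∀ W : X.affineOpens, (I.ideal W).FG) ∧
      Disjoint (U : Set X) (I.support : Set X) ∧
      ∃ (f' : V ⟶ X') (_ : QuasiCompact f') (_ : QuasiSeparated f')
        (hρ' : ∀ g, (ρ g).hom ≫ f' = f'),
        f' ≫ φ = f ∧
          ∀ y : ↥f'.normalization,
            HasNormalSylow p (inertiaSubgroup (normalizationAction f' ρ hρ') y) := by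
  obtain ⟨X', φ, I, hb, hfg, hdisj, f', hqc, hqs, hρ', hf', hN'⟩ :=
    h p k X sX hft hN U hU G V f ρ hρ hf hfU htors
  exact ⟨X', φ, I, hb, hfg, hdisj, f', hqc, hqs, hρ', hf', inertiaNormalSylow_iff_forall.mp hN'⟩

end Literature.AlgebraicGeometry.Ramification

end
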